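import Summits.CriticalPhenomena.PercolationContinuityZ3.Theorems.PercNearOneGluingNoHeavyLowerTailThreePointCPIClusterSwapDefs
import Summits.CriticalPhenomena.PercolationContinuityZ3.Theorems.PercNearOneGluingNoHeavyLowerTailThreePointTransplantRecipes
import HarnessLib

/-!
# The product form `#bad² ≤ #P1·#P2` in the fibre language: the adjacent-apex case
# (Sahi programme, prover prim-sahi-p2 gen 54)

Support file (`--supports stmt-CriticalPhenomena-4575`, helper); companion of `…ThreePointProductForm` (gen 53, the law-level
consequences of CONJECTURE (P)) and `…ThreePointProductFormCertificate` (gen 54, the certificate shape).  This file is the first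
statement of the objects of (P) in the FIBRE LANGUAGE of the tree (`Literature/Probability/Percolation/ComplementPatternCounts.lean`:
a finite multigraph `(V, α, ends)`, configurations `z : α → Bool`, open connection `(openGraph (labelledOpen ends z)).Reachable`;
the flat `♭z` of the memos is `clusterFlip ends a (fun l => !z l)` of `…ThreePointCPIClusterSwapDefs`: keep the complement on the labels
touching the open cluster of `a`, keep `z` elsewhere).  Standard axioms, no sorries, no named facts, no definitions (statements spelled
out with `Finset.filter`).  Memo `run/shared/lean/prim/prim-sahi/FROM-prim-sahi-p2-gen54-CERTIFICATE-SHAPE.md` §0(4).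

With `R z x y := (openGraph (labelledOpen ends z)).Reachable x y`:  `S0 = {z : ¬R a s ∧ ¬R a c ∧ ¬R s c}` (all three separated),
`P1 = {z : R a s ∧ ¬R a c}`, `P2 = {z : R a c ∧ ¬R a s}`, `bad = {z ∈ S0 : R (♭z) s c}`.
* **`reachable_update_true`** [this work] — opening one label `ℓ` with `ends ℓ = s(a,s)` only joins the clusters of `a` and `s`:
  `R z' a v → R z a v ∨ R z s v` for `z' = Function.update z ℓ true` (closed-set argument, `TransplantRecipes.mem_of_walk`).
* **`card_sep_le_card_sa_of_label`** [this work] — if the multigraph has a label from `a` to `s` then `z ↦ update z ℓ true` injects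
  `S0` into `P1`, so `#S0 ≤ #P1`; hence **`card_bad_le_card_sa_of_label`**: `#bad ≤ #P1` (any sub-family of `S0`, in particular `bad`).
* **`productForm_of_labels`** [this work] — if `a` is joined by labels to both `s` and `c` then `#bad² ≤ #P1·#P2` (indeed
  `#bad ≤ min(#P1,#P2)`): CONJECTURE (P) in the doubly-adjacent case, which contains the tight family 's, c pendant at a' of gen 53.
So (P) is open only when the apex `a` is NOT adjacent to `s` or to `c` (claw, `K22a`, the fibre `H₄` of the memo); there `#bad > #P1`
occurs and the memo's product-Hall obstruction shows that no monotone map can work.  [folklore] (closed-set / injection counting);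
[cite: Gladkov2024, Conjecture 10.1 (p. 18), arXiv:2408.08457] for the conjecture served.
-/

namespace Summit.CriticalPhenomena.PercolationContinuityZ3.Theorems.ProductFormFibre

open Finset Literature.Probability.Percolation
open Summit.CriticalPhenomena.PercolationContinuityZ3.Theorems.ThreePointCPIClusterSwap (clusterFlip)

variable {V α : Type*}

/-! ### 1. Opening one `a–s` label only merges the clusters of `a` and `s` -/

/-- An open label of `Function.update z ℓ true` other than `ℓ` is an open label of `z`. [folklore] -/
theorem update_true_apply_of_ne [DecidableEq α] (z : α → Bool) (ℓ : α) {b : α} (hb : b ≠ ℓ)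
    (h : Function.update z ℓ true b = true) : z b = true := by
  rwa [Function.update_of_ne hb] at h

/-- **Opening one label `ℓ` with endpoints `a, s` only joins the clusters of `a` and `s`**: every vertex reachable from `a` after
opening `ℓ` was reachable from `a` or from `s` before. [this work] -/
theorem reachable_update_true [DecidableEq α] (ends : α → Sym2 V) (z : α → Bool) {ℓ : α} {a s : V}
    (hℓ : ends ℓ = s(a, s)) {v : V}
    (hv : (openGraph (labelledOpen ends (Function.update z ℓ true))).Reachable a v) :
    (openGraph (labelledOpen ends z)).Reachable a v ∨ (openGraph (labelledOpen ends z)).Reachable s v := by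
  obtain ⟨p⟩ := hv
  refine TransplantRecipes.mem_of_walk (G := openGraph (labelledOpen ends (Function.update z ℓ true)))
    (S := {v | (openGraph (labelledOpen ends z)).Reachable a v ∨ (openGraph (labelledOpen ends z)).Reachable s v})
    ?_ p (Or.inl (SimpleGraph.Reachable.refl a))
  intro u w hu hadj
  rw [openGraph_adj] at hadj
  obtain ⟨⟨b, hb, hbe⟩, huw⟩ := hadj
  by_cases hbl : b = ℓ
  · -- the new label: its endpoints are `a` and `s`
    subst hbl
    rw [hℓ] at hbe
    have hw : w ∈ (s(a, s) : Sym2 V) := by rw [hbe]; exact Sym2.mem_mk_right u w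
    rcases Sym2.mem_iff.1 hw with rfl | rfl
    · exact Or.inl (SimpleGraph.Reachable.refl _)
    · exact Or.inr (SimpleGraph.Reachable.refl _)
  · have hzb : z b = true := update_true_apply_of_ne z ℓ hbl hb
    have hadj' : (openGraph (labelledOpen ends z)).Adj u w := by
      rw [openGraph_adj]; exact ⟨⟨b, hzb, hbe⟩, huw⟩
    rcases hu with h | h
    · exact Or.inl (h.trans hadj'.reachable)
    · exact Or.inr (h.trans hadj'.reachable)

/-- After opening a label with endpoints `a ≠ s`, `a` is joined to `s`. [folklore] -/
theorem reachable_update_true_self [DecidableEq α] (ends : α → Sym2 V) (z : α → Bool) {ℓ : α} {a s : V}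
    (hℓ : ends ℓ = s(a, s)) (has : a ≠ s) :
    (openGraph (labelledOpen ends (Function.update z ℓ true))).Reachable a s := by
  refine SimpleGraph.Adj.reachable ?_
  rw [openGraph_adj]
  exact ⟨⟨ℓ, Function.update_self ℓ true z, hℓ⟩, has⟩

/-- If `a` and `s` are separated in `z` then every `a–s` label is closed in `z`. [folklore] -/
theorem apply_eq_false_of_not_reachable (ends : α → Sym2 V) (z : α → Bool) {ℓ : α} {a s : V}
    (hℓ : ends ℓ = s(a, s)) (has : a ≠ s) (h : ¬ (openGraph (labelledOpen ends z)).Reachable a s) :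
    z ℓ = false := by
  by_contra hne
  have hz : z ℓ = true := by cases h' : z ℓ <;> simp_all
  apply h
  refine SimpleGraph.Adj.reachable ?_
  rw [openGraph_adj]
  exact ⟨⟨ℓ, hz, hℓ⟩, has⟩

/-! ### 2. `#S0 ≤ #P1` when `a` is adjacent to `s`, hence `#bad ≤ #P1` -/

section Counts

variable [Fintype α] [DecidableEq α]

open Classical in
/-- **`#S0 ≤ #P1` when the apex is adjacent to `s`.**  If some label `ℓ` has endpoints `a, s` (`a ≠ s`), then
`z ↦ Function.update z ℓ true` maps the totally separated configurations `S0 = {a ↮ s, a ↮ c, s ↮ c}` injectively into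
`P1 = {a ↔ s, a ↮ c}`. [this work] -/
theorem card_sep_le_card_sa_of_label (ends : α → Sym2 V) {a s c : V} {ℓ : α} (hℓ : ends ℓ = s(a, s)) (has : a ≠ s) :
    (univ.filter fun z : α → Bool =>
        ¬ (openGraph (labelledOpen ends z)).Reachable a s ∧ ¬ (openGraph (labelledOpen ends z)).Reachable a c ∧
        ¬ (openGraph (labelledOpen ends z)).Reachable s c).card ≤
    (univ.filter fun z : α → Bool =>
        (openGraph (labelledOpen ends z)).Reachable a s ∧ ¬ (openGraph (labelledOpen ends z)).Reachable a c).card := by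
  refine Finset.card_le_card_of_injOn (fun z => Function.update z ℓ true) ?_ ?_
  · intro z hz
    rw [Finset.mem_coe, Finset.mem_filter] at hz
    obtain ⟨-, hAS, hAC, hSC⟩ := hz
    rw [Finset.mem_coe, Finset.mem_filter]
    refine ⟨Finset.mem_univ _, reachable_update_true_self ends z hℓ has, fun hac => ?_⟩
    rcases reachable_update_true ends z hℓ hac with h | h
    · exact hAC h
    · exact hSC h
  · intro z₁ hz₁ z₂ hz₂ heq
    rw [Finset.mem_coe, Finset.mem_filter] at hz₁ hz₂
    have h₁ : z₁ ℓ = false := apply_eq_false_of_not_reachable ends z₁ hℓ has hz₁.2.1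
    have h₂ : z₂ ℓ = false := apply_eq_false_of_not_reachable ends z₂ hℓ has hz₂.2.1
    funext b
    by_cases hb : b = ℓ
    · rw [hb, h₁, h₂]
    · have := congrArg (fun w : α → Bool => w b) heq
      simpa only [Function.update_of_ne hb] using this

open Classical in
/-- **`#bad ≤ #P1` when the apex is adjacent to `s`**: the bad configurations (totally separated, with `s ↔ c` after the flat
`♭z = clusterFlip ends a z̄` — or any further condition `Φ`) form a sub-family of `S0`. [this work] -/
theorem card_bad_le_card_sa_of_label (ends : α → Sym2 V) {a s c : V} {ℓ : α} (hℓ : ends ℓ = s(a, s)) (has : a ≠ s)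
    (Φ : (α → Bool) → Prop) :
    (univ.filter fun z : α → Bool =>
        (¬ (openGraph (labelledOpen ends z)).Reachable a s ∧ ¬ (openGraph (labelledOpen ends z)).Reachable a c ∧
          ¬ (openGraph (labelledOpen ends z)).Reachable s c) ∧ Φ z).card ≤
    (univ.filter fun z : α → Bool =>
        (openGraph (labelledOpen ends z)).Reachable a s ∧ ¬ (openGraph (labelledOpen ends z)).Reachable a c).card := by
  refine le_trans (Finset.card_le_card ?_) (card_sep_le_card_sa_of_label ends hℓ has (c := c))
  intro z hz
  rw [Finset.mem_filter] at hz ⊢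
  exact ⟨hz.1, hz.2.1⟩

open Classical in
/-- **CONJECTURE (P) in the doubly-adjacent case.**  If the apex `a` is joined by labels to both `s` and `c` (`a ≠ s`, `a ≠ c`),
then in the fibre language `#bad² ≤ #P1 · #P2`, where `bad = {z : a ↮ s, a ↮ c, s ↮ c in z, and s ↔ c in ♭z}` with
`♭z = clusterFlip ends a (fun l => !z l)` (complement on the labels touching the open cluster of `a`), `P1 = {a ↔ s, a ↮ c}`,
`P2 = {a ↔ c, a ↮ s}`; in fact `#bad ≤ #P1` and `#bad ≤ #P2`. [this work] -/
theorem productForm_of_labels (ends : α → Sym2 V) {a s c : V} {ℓ₁ ℓ₂ : α} (h₁ : ends ℓ₁ = s(a, s)) (h₂ : ends ℓ₂ = s(a, c))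
    (has : a ≠ s) (hac : a ≠ c) :
    (univ.filter fun z : α → Bool =>
        (¬ (openGraph (labelledOpen ends z)).Reachable a s ∧ ¬ (openGraph (labelledOpen ends z)).Reachable a c ∧
          ¬ (openGraph (labelledOpen ends z)).Reachable s c) ∧
        (openGraph (labelledOpen ends (clusterFlip ends a fun l => !z l))).Reachable s c).card ^ 2 ≤
    (univ.filter fun z : α → Bool =>
        (openGraph (labelledOpen ends z)).Reachable a s ∧ ¬ (openGraph (labelledOpen ends z)).Reachable a c).card *
    (univ.filter fun z : α → Bool =>
        (openGraph (labelledOpen ends z)).Reachable a c ∧ ¬ (openGraph (labelledOpen ends z)).Reachable a s).card := by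
  have hP1 := card_bad_le_card_sa_of_label ends h₁ has (c := c)
    (Φ := fun z => (openGraph (labelledOpen ends (clusterFlip ends a fun l => !z l))).Reachable s c)
  -- the `c`-side: the same lemma with the roles of `s` and `c` exchanged
  have hP2' := card_bad_le_card_sa_of_label ends h₂ hac (c := s)
    (Φ := fun z => (openGraph (labelledOpen ends (clusterFlip ends a fun l => !z l))).Reachable s c)
  have hP2 : (univ.filter fun z : α → Bool =>
        (¬ (openGraph (labelledOpen ends z)).Reachable a s ∧ ¬ (openGraph (labelledOpen ends z)).Reachable a c ∧
          ¬ (openGraph (labelledOpen ends z)).Reachable s c) ∧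
        (openGraph (labelledOpen ends (clusterFlip ends a fun l => !z l))).Reachable s c).card ≤
      (univ.filter fun z : α → Bool =>
        (openGraph (labelledOpen ends z)).Reachable a c ∧ ¬ (openGraph (labelledOpen ends z)).Reachable a s).card := by
    refine le_trans (le_of_eq ?_) hP2'
    congr 1
    ext z
    simp only [Finset.mem_filter, Finset.mem_univ, true_and]
    constructor
    · rintro ⟨⟨h1, h2, h3⟩, h4⟩
      exact ⟨⟨h2, h1, fun h => h3 h.symm⟩, h4⟩
    · rintro ⟨⟨h1, h2, h3⟩, h4⟩
      exact ⟨⟨h2, h1, fun h => h3 h.symm⟩, h4⟩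
  calc _ = _ * _ := sq _
    _ ≤ _ := Nat.mul_le_mul hP1 hP2

end Counts

end Summit.CriticalPhenomena.PercolationContinuityZ3.Theorems.ProductFormFibre
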